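import Literature.Analysis.FluidPDE.UniversalTotalAnomalousDissipator
import Literature.Analysis.FluidPDE.AgeDecouplingGridPairing
import HarnessLib

/-!
# Hess-Childs–Rowan (2025), a universal total anomalous dissipator — proved bookkeeping

Companion of `UniversalTotalAnomalousDissipator.lean` (E. Hess-Childs, K. Rowan, *A universal total
anomalous dissipator*, arXiv:2501.18526 (2025), Thm. 1.1, Def. 1.2, Cor. 1.3 [cite: HessChildsRowan2025a]):
theorems only, no new facts.

* API of the clause predicates: `Torus.IsL2ContinuousOn.memLp/.mono`, the projections of
  `HessChildsRowan2025a.IsCarrier`, and the case analysis of the forward–backward field `W` of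
  Def. 1.2 (`forwardBackwardField_eq_zero_of_lt`, `_of_gt`, `_of_mem_Ico`, `_of_mem_Ioc`; for a
  carrier, `W = 0` on `t ≤ 3/8` and on `5/8 ≤ t`, since `V = 0` for `t ≤ 1/2`).
* `HessChildsRowan2025a_thm11_of_cor13`: Theorem 1.1 is a projection of the typed Corollary 1.3
  (same `V`).
* `HessChildsRowan2025a.DissipatesAllNorms.scalarL2Sq_one_le`: the `p = 2` case of (1.3) in the
  tree's squared currency, `‖θ(1)‖²_{L²} ≤ (C κ^{(1-α)²/72})² ‖θ₀‖²_{L²}`, and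
  `….tendsto_scalarL2Sq_one`: along any `κⱼ → 0⁺` the energies at time `1` of the solutions of a
  fixed datum tend to `0` — the abstract's "asymptotic total dissipation for all mean-zero initial
  data: `lim_{κ→0} ‖θ^κ(1,·)‖_{L²} = 0`".
-/

noncomputable section

namespace Literature.Analysis.FluidPDE

open _root_.MeasureTheory _root_.Set _root_.Filter
open scoped NNReal ENNReal Topology

namespace Torus

variable {d : Type*} [Fintype d]

/-- A `C(S; L²)` representative is in `L²` at each time of `S`. [cite: ArmstrongVicol2025, Thm. 1.1 p. 3 (the class `C([0,1];L²(T^d))`)] -/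
theorem IsL2ContinuousOn.memLp {S : Set ℝ} {θ : ℝ → UnitAddTorus d → ℝ}
    (h : IsL2ContinuousOn S θ) {t : ℝ} (ht : t ∈ S) : MemLp (θ t) 2 volume :=
  h.1 t ht

/-- `L²`-continuity at a time of `S`, within `S`. [cite: ArmstrongVicol2025, Thm. 1.1 p. 3 (the class `C([0,1];L²(T^d))`)] -/
theorem IsL2ContinuousOn.tendsto {S : Set ℝ} {θ : ℝ → UnitAddTorus d → ℝ}
    (h : IsL2ContinuousOn S θ) {t₀ : ℝ} (ht₀ : t₀ ∈ S) :
    Tendsto (fun t => Torus.scalarL2Sq (θ t - θ t₀)) (𝓝[S] t₀) (𝓝 0) :=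
  h.2 t₀ ht₀

/-- Restricting the time set preserves `C(S; L²)`. [cite: ArmstrongVicol2025, Thm. 1.1 p. 3 (the class `C([0,1];L²(T^d))`)] -/
theorem IsL2ContinuousOn.mono {S S' : Set ℝ} {θ : ℝ → UnitAddTorus d → ℝ}
    (h : IsL2ContinuousOn S θ) (hS : S' ⊆ S) : IsL2ContinuousOn S' θ :=
  ⟨fun t ht => h.1 t (hS ht), fun t₀ ht₀ => (h.2 t₀ (hS ht₀)).mono_left (nhdsWithin_mono _ hS)⟩

/-- A time-independent `L²` field is its own `L²`-continuous representative (non-vacuity of the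
predicate). [cite: ArmstrongVicol2025, Thm. 1.1 p. 3 (the class `C([0,1];L²(T^d))`)] -/
theorem isL2ContinuousOn_const (S : Set ℝ) {f : UnitAddTorus d → ℝ} (hf : MemLp f 2 volume) :
    IsL2ContinuousOn S (fun _ => f) := by
  refine ⟨fun t _ => hf, fun t₀ _ => ?_⟩
  simpa [Torus.scalarL2Sq] using tendsto_const_nhds

end Torus

namespace HessChildsRowan2025a

variable {α : ℝ≥0} {V : ℝ → UnitAddTorus (Fin 2) → EuclideanSpace ℝ (Fin 2)}

/-! ## Projections of the carrier class -/

/-- A carrier is space–time measurable. [cite: HessChildsRowan2025a, Lemma 2.12 p. 12] -/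
theorem IsCarrier.aestronglyMeasurable (h : IsCarrier α V) :
    AEStronglyMeasurable (FunctionSpaces.Torus.stLift V) volume :=
  h.1

/-- A carrier is bounded, `α`-Hölder in space with one constant, and Hölder in time on `[0,1]`.
[cite: HessChildsRowan2025a, Lemma 2.12 p. 12] -/
theorem IsCarrier.exists_const (h : IsCarrier α V) :
    ∃ A : ℝ≥0, (∀ (t : ℝ) (x : UnitAddTorus (Fin 2)), ‖V t x‖ ≤ A) ∧
      (∀ t : ℝ, HolderWith A α (V t)) ∧
      (∀ (x : UnitAddTorus (Fin 2)), ∀ s ∈ Icc (0 : ℝ) 1, ∀ t ∈ Icc (0 : ℝ) 1,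
        ‖V t x - V s x‖ ≤ (A : ℝ) * |t - s| ^ min (1 : ℝ) ((α : ℝ) / (1 - (α : ℝ)))) :=
  h.2.1

/-- A carrier is weakly divergence free at every time. [cite: HessChildsRowan2025a, Thm. 1.1 p. 1 ("divergence-free")] -/
theorem IsCarrier.isWeaklyDivFree (h : IsCarrier α V) (t : ℝ) :
    FunctionSpaces.Torus.IsWeaklyDivFree (V t) :=
  h.2.2.1 t

/-- A carrier vanishes for `t ≤ 1/2` ((2.4)). [cite: HessChildsRowan2025a, Def. 2.11 (2.4) p. 11] -/
theorem IsCarrier.eq_zero_of_le_half (h : IsCarrier α V) {t : ℝ} (ht : t ≤ 1 / 2) : V t = 0 :=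
  h.2.2.2 t ht

/-- The zero field is a carrier for every exponent (non-vacuity of the clause predicate; the
content of Theorem 1.1 is the dissipation clause). [cite: HessChildsRowan2025a, Lemma 2.12 p. 12] -/
theorem isCarrier_zero (α : ℝ≥0) : IsCarrier α (fun _ _ => 0) := by
  refine ⟨aestronglyMeasurable_const, ⟨0, fun t x => by simp, fun t => fun x y => by simp,
    fun x s _ t _ => by simp⟩, fun t θ _ => by simp, fun t _ => rfl⟩

/-! ## The forward–backward field of Definition 1.2 -/

/-- Before `t = 1/4` the forward–backward field vanishes (heat flow only). [cite: HessChildsRowan2025a, Def. 1.2 p. 2] -/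
theorem forwardBackwardField_eq_zero_of_lt {t : ℝ} (ht : t < 1 / 4) (x : UnitAddTorus (Fin 2)) :
    forwardBackwardField V t x = 0 := by
  have h1 : t ∉ Icc (1 / 4 : ℝ) (1 / 2) := fun h => absurd h.1 (not_le.2 ht)
  have h2 : t ∉ Icc (1 / 2 : ℝ) (3 / 4) := fun h => absurd h.1 (by linarith)
  simp only [forwardBackwardField, h1, h2, if_false, add_zero]

/-- After `t = 3/4` the forward–backward field vanishes (heat flow only). [cite: HessChildsRowan2025a, Def. 1.2 p. 2] -/
theorem forwardBackwardField_eq_zero_of_gt {t : ℝ} (ht : 3 / 4 < t) (x : UnitAddTorus (Fin 2)) :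
    forwardBackwardField V t x = 0 := by
  have h1 : t ∉ Icc (1 / 4 : ℝ) (1 / 2) := fun h => absurd h.2 (by linarith)
  have h2 : t ∉ Icc (1 / 2 : ℝ) (3 / 4) := fun h => absurd h.2 (not_le.2 ht)
  simp only [forwardBackwardField, h1, h2, if_false, add_zero]

/-- On `[1/4, 1/2)` the forward–backward field is `V` run forward at speed `4`:
`W(t) = 4 V(4t - 1)`. [cite: HessChildsRowan2025a, Def. 1.2 p. 2; §2.5 p. 13] -/
theorem forwardBackwardField_of_mem_Ico {t : ℝ} (ht : t ∈ Ico (1 / 4 : ℝ) (1 / 2))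
    (x : UnitAddTorus (Fin 2)) : forwardBackwardField V t x = (4 : ℝ) • V (4 * t - 1) x := by
  have h1 : t ∈ Icc (1 / 4 : ℝ) (1 / 2) := ⟨ht.1, ht.2.le⟩
  have h2 : t ∉ Icc (1 / 2 : ℝ) (3 / 4) := fun h => absurd h.1 (not_le.2 ht.2)
  simp only [forwardBackwardField, h1, h2, if_true, if_false, add_zero]

/-- On `(1/2, 3/4]` the forward–backward field is `V` run backward at speed `4`:
`W(t) = 4 V(3 - 4t)`. [cite: HessChildsRowan2025a, Def. 1.2 p. 2; §2.5 p. 13] -/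
theorem forwardBackwardField_of_mem_Ioc {t : ℝ} (ht : t ∈ Ioc (1 / 2 : ℝ) (3 / 4))
    (x : UnitAddTorus (Fin 2)) : forwardBackwardField V t x = (4 : ℝ) • V (3 - 4 * t) x := by
  have h1 : t ∉ Icc (1 / 4 : ℝ) (1 / 2) := fun h => absurd h.2 (not_le.2 ht.1)
  have h2 : t ∈ Icc (1 / 2 : ℝ) (3 / 4) := ⟨ht.1.le, ht.2⟩
  simp only [forwardBackwardField, h1, h2, if_true, if_false, zero_add]

/-- At the junction `t = 1/2` both indicators are `1`, as printed: `W(1/2) = 8 V(1)` (a single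
instant, invisible to weak solutions). [cite: HessChildsRowan2025a, Def. 1.2 p. 2] -/
theorem forwardBackwardField_half (x : UnitAddTorus (Fin 2)) :
    forwardBackwardField V (1 / 2) x = (8 : ℝ) • V 1 x := by
  have h1 : (1 / 2 : ℝ) ∈ Icc (1 / 4 : ℝ) (1 / 2) := by constructor <;> norm_num
  have h2 : (1 / 2 : ℝ) ∈ Icc (1 / 2 : ℝ) (3 / 4) := by constructor <;> norm_num
  simp only [forwardBackwardField, h1, h2, if_true]
  rw [show (4 : ℝ) * (1 / 2) - 1 = 1 by norm_num, show (3 : ℝ) - 4 * (1 / 2) = 1 by norm_num,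
    ← add_smul]
  norm_num

/-- For a carrier (`V = 0` for `t ≤ 1/2`) the forward leg is silent until `t = 3/8`:
`W(t) = 0` for `t ≤ 3/8`. [cite: HessChildsRowan2025a, Def. 1.2 p. 2; (2.4) p. 11] -/
theorem IsCarrier.forwardBackwardField_eq_zero_of_le (h : IsCarrier α V) {t : ℝ} (ht : t ≤ 3 / 8)
    (x : UnitAddTorus (Fin 2)) : forwardBackwardField V t x = 0 := by
  have hV : V (4 * t - 1) = 0 := h.eq_zero_of_le_half (by linarith)
  have h2 : t ∉ Icc (1 / 2 : ℝ) (3 / 4) := fun h' => absurd h'.1 (by linarith)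
  simp only [forwardBackwardField, h2, if_false, add_zero, hV, Pi.zero_apply, smul_zero, ite_self]

/-- For a carrier the backward leg is silent from `t = 5/8` on: `W(t) = 0` for `5/8 ≤ t`. [cite: HessChildsRowan2025a, Def. 1.2 p. 2; (2.4) p. 11] -/
theorem IsCarrier.forwardBackwardField_eq_zero_of_ge (h : IsCarrier α V) {t : ℝ} (ht : 5 / 8 ≤ t)
    (x : UnitAddTorus (Fin 2)) : forwardBackwardField V t x = 0 := by
  have hV : V (3 - 4 * t) = 0 := h.eq_zero_of_le_half (by linarith)
  have h1 : t ∉ Icc (1 / 4 : ℝ) (1 / 2) := fun h' => absurd h'.2 (by linarith)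
  simp only [forwardBackwardField, h1, if_false, zero_add, hV, Pi.zero_apply, smul_zero, ite_self]

/-! ## Consumer forms of the dissipation clauses -/

/-- **The `p = 2` case of (1.3) in squared currency**: under `DissipatesAllNorms α W` with constant
`C`, every mean-zero `L²` datum and every `L²`-continuous weak solution have
`‖θ(1)‖²_{L²} ≤ (C κ^{(1-α)²/72})² ‖θ₀‖²_{L²}` (`Torus.scalarL2Sq`). [cite: HessChildsRowan2025a, Cor. 1.3 (1.3) p. 2 (p = 2)] -/
theorem DissipatesAllNorms.scalarL2Sq_one_le {W : ℝ → UnitAddTorus (Fin 2) → EuclideanSpace ℝ (Fin 2)}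
    (h : DissipatesAllNorms α W) :
    ∃ C : ℝ, 0 < C ∧ ∀ κ : ℝ, 0 < κ →
      ∀ θ₀ : UnitAddTorus (Fin 2) → ℝ, MemLp θ₀ 2 volume → ∫ x, θ₀ x = 0 →
        ∀ θ : ℝ → UnitAddTorus (Fin 2) → ℝ,
          Torus.IsWeakScalarTransportDiagOn 1 ![2⁻¹, 1] κ W θ₀ θ →
          Torus.IsL2ContinuousOn (Icc 0 1) θ →
            Torus.scalarL2Sq (θ 1) ≤
              (C * κ ^ ((1 - (α : ℝ)) ^ 2 / 72)) ^ 2 * Torus.scalarL2Sq θ₀ := by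
  obtain ⟨C, hC, H⟩ := h
  refine ⟨C, hC, fun κ hκ θ₀ hθ₀ hmean θ hsol hcont => ?_⟩
  have h2 := (H κ hκ θ₀ hθ₀ hmean θ hsol hcont).1 2 (by norm_num)
  have h1 : MemLp (θ 1) 2 volume := hcont.memLp ⟨zero_le_one, le_rfl⟩
  set R : ℝ := C * κ ^ ((1 - (α : ℝ)) ^ 2 / 72) with hR
  have hR0 : 0 ≤ R := (mul_pos hC (Real.rpow_pos_of_pos hκ _)).le
  -- square the `eLpNorm` inequality and convert both sides to `scalarL2Sq`
  have hsq : eLpNorm (θ 1) 2 volume ^ 2 ≤ (ENNReal.ofReal R * eLpNorm θ₀ 2 volume) ^ 2 :=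
    pow_le_pow_left' h2 2
  rw [mul_pow, FunctionSpaces.eLpNorm_two_pow_two_eq_lintegral,
    FunctionSpaces.eLpNorm_two_pow_two_eq_lintegral, ← Torus.ofReal_scalarL2Sq_eq h1,
    ← Torus.ofReal_scalarL2Sq_eq hθ₀, ← ENNReal.ofReal_pow hR0, ← ENNReal.ofReal_mul (sq_nonneg _)] at hsq
  exact (ENNReal.ofReal_le_ofReal_iff (mul_nonneg (sq_nonneg _) (Torus.scalarL2Sq_nonneg _))).1 hsq

/-- **Asymptotic total dissipation of every datum** (the abstract: "`lim_{κ→0} ‖θ^κ(1,·)‖_{L²} = 0`"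
for all mean-zero initial data): under `DissipatesAllNorms α W` with `α < 1`, for a fixed mean-zero
`L²` datum, along ANY sequence `κⱼ → 0⁺` and any `L²`-continuous weak solutions `θⱼ` with
diffusivity `κⱼ`, `‖θⱼ(1)‖²_{L²} → 0`. [cite: HessChildsRowan2025a, Cor. 1.3 (1.3) p. 2; Abstract p. 1] -/
theorem DissipatesAllNorms.tendsto_scalarL2Sq_one
    {W : ℝ → UnitAddTorus (Fin 2) → EuclideanSpace ℝ (Fin 2)} (h : DissipatesAllNorms α W)
    (hα : α < 1) {θ₀ : UnitAddTorus (Fin 2) → ℝ} (hθ₀ : MemLp θ₀ 2 volume) (hmean : ∫ x, θ₀ x = 0)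
    {κ : ℕ → ℝ} (hκpos : ∀ j, 0 < κ j) (hκ : Tendsto κ atTop (𝓝 0))
    {θ : ℕ → ℝ → UnitAddTorus (Fin 2) → ℝ}
    (hsol : ∀ j, Torus.IsWeakScalarTransportDiagOn 1 ![2⁻¹, 1] (κ j) W θ₀ (θ j))
    (hcont : ∀ j, Torus.IsL2ContinuousOn (Icc 0 1) (θ j)) :
    Tendsto (fun j => Torus.scalarL2Sq (θ j 1)) atTop (𝓝 0) := by
  obtain ⟨C, hC, H⟩ := h.scalarL2Sq_one_le
  set e : ℝ := (1 - (α : ℝ)) ^ 2 / 72 with he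
  have he0 : 0 < e := by
    have : (α : ℝ) < 1 := by exact_mod_cast hα
    have h1 : 0 < 1 - (α : ℝ) := by linarith
    positivity
  -- the majorant `(C κⱼ^e)² ‖θ₀‖²` tends to `0`
  have hmaj : Tendsto (fun j => (C * κ j ^ e) ^ 2 * Torus.scalarL2Sq θ₀) atTop (𝓝 0) := by
    have hpow : Tendsto (fun j => κ j ^ e) atTop (𝓝 0) := by
      have hc : Tendsto (fun x : ℝ => x ^ e) (𝓝 0) (𝓝 ((0 : ℝ) ^ e)) :=
        (Real.continuousAt_rpow_const 0 e (Or.inr he0.le)).tendsto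
      rw [Real.zero_rpow he0.ne'] at hc
      exact hc.comp hκ
    have : Tendsto (fun j => (C * κ j ^ e) ^ 2 * Torus.scalarL2Sq θ₀) atTop
        (𝓝 ((C * 0) ^ 2 * Torus.scalarL2Sq θ₀)) :=
      ((hpow.const_mul C).pow 2).mul_const _
    simpa using this
  refine squeeze_zero (fun j => Torus.scalarL2Sq_nonneg _) (fun j => ?_) hmaj
  exact H (κ j) (hκpos j) θ₀ hθ₀ hmean (θ j) (hsol j) (hcont j)

end HessChildsRowan2025a

/-- **Theorem 1.1 is a projection of the typed Corollary 1.3** (which repeats the clauses of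
Thm. 1.1 for the same field `V`, recorded reading 5 of `UniversalTotalAnomalousDissipator.lean`). [cite: HessChildsRowan2025a, Thm. 1.1 p. 1; Cor. 1.3 p. 2] -/
theorem HessChildsRowan2025a_thm11_of_cor13 (h : HessChildsRowan2025a_cor13) :
    HessChildsRowan2025a_thm11 := by
  intro α h0 h1
  obtain ⟨V, hV, hD, -⟩ := h α h0 h1
  exact ⟨V, hV, hD⟩

end Literature.Analysis.FluidPDE

end
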